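import Summits.Parity.GeneralizedHardyLittlewood.Theorems.FordMaynardSieveConst01651SieveConst01651BuchstabTableSound
import Summits.Parity.GeneralizedHardyLittlewood.Theorems.FordMaynardSieveConst01651SieveConst01651CertLookups
import Summits.Parity.GeneralizedHardyLittlewood.Theorems.FordMaynardSieveConst01651SieveConst01651BuchstabCertBounds
import HarnessLib

/-!
# Route `FordMaynardSieveConst01651`, target `SieveConst01651` (stmt-Parity-19185), stub `stub_certValuePos` (R2):
# the range lookups of the checker enclose Buchstab's `Φ₆`

Def-free helper file (step (6) of the `certP`/`certN` soundness, see `…CertAssembly`): for every grid cell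
`m ∈ [lo, hi) ⊆ [60000, 80384)` and every `y ∈ (x_m, x_{m+1}]`,

  `phiLoRange certBlockLo lo hi / D ≤ Φ₆(y) ≤ phiHiRange certBlockHi lo hi / D`   (`phiSix_range_bounds`),

combining the table enclosure `…BuchstabTableSound.phiSix_cell_bounds`, the identification of the cell lists
`certCellsLo/Hi` with the generations `3, 4` of the table (`certCellsLo_getD`, `certCellsHi_getD`), and the packed
lookups `…CertLookups.phiLoRange_le / le_phiHiRange` (digits `< 2⁴⁸` by `…BuchstabCertBounds`).

References: [FordMaynard2024PrimeSieves] arXiv:2407.14368, Theorem 7.3 (a), §8.2.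
-/

noncomputable section

open MeasureTheory Set Finset
open scoped Classical
open Literature.NumberTheory.Sieve Literature.NumberTheory.Sieve.FordMaynard
open Literature.Analysis.Convolution

namespace Summit.Parity.GeneralizedHardyLittlewood.FordMaynardSieveConst01651SieveConst01651

/-- The `Φ⁻`/`Φ⁺` lists of generation `g ≥ 1` have length `K`. [folklore] -/
theorem tabRun_phi_length (J D K g : ℕ) (hg : 1 ≤ g) :
    (tabRun J D K g).phiLo.length = K ∧ (tabRun J D K g).phiHi.length = K := by
  obtain ⟨g', rfl⟩ : ∃ g', g = g' + 1 := ⟨g - 1, by omega⟩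
  cases g' with
  | zero =>
    have h := tabGen_length J D K K (List.replicate K 0) (List.replicate K 0) 0 0
    exact ⟨h.1, h.2.1⟩
  | succ g'' =>
    show (tabNext J D K (g'' + 2) (tabRun J D K (g'' + 1))).phiLo.length = K ∧
      (tabNext J D K (g'' + 2) (tabRun J D K (g'' + 1))).phiHi.length = K
    unfold tabNext
    have h := tabGen_length J D K ((g'' + 2) * K) (tabRun J D K (g'' + 1)).psiLo
      ((tabRun J D K (g'' + 1)).psiHi.tail ++ [(tabRun J D K (g'' + 1)).ph]) (tabRun J D K (g'' + 1)).pl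
      (tabRun J D K (g'' + 1)).ph
    exact ⟨h.1, h.2.1⟩

/-- Index bookkeeping of the concatenated cell list: cells `60000 … 79247` come from generation `3` (offset `564`),
cells `79248 … 80383` from generation `4`. [folklore] -/
theorem cells_getD (L3 L4 : List ℕ) (hL3 : L3.length = tabK) {m : ℕ}
    (h1 : 60000 ≤ m) (h2 : m < 80384) :
    (L3.drop 564 ++ L4.take 1136).getD (m - 60000) 0 =
      (if m / tabK = 3 then L3 else L4).getD (m % tabK) 0 := by
  have hK : tabK = 19812 := rfl
  by_cases hm : m < 79248
  · have hdiv : m / tabK = 3 := by rw [hK]; omega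
    have hmod : m % tabK = m - 59436 := by rw [hK]; omega
    rw [if_pos hdiv, hmod, List.getD_append _ _ _ _ (by rw [List.length_drop, hL3, hK]; omega),
      List.getD_eq_getElem?_getD, List.getD_eq_getElem?_getD, List.getElem?_drop,
      show 564 + (m - 60000) = m - 59436 by omega]
  · have hdiv : m / tabK = 4 := by rw [hK]; omega
    have hmod : m % tabK = m - 79248 := by rw [hK]; omega
    rw [if_neg (by omega), hmod, List.getD_append_right _ _ _ _ (by rw [List.length_drop, hL3, hK]; omega),
      List.length_drop, hL3, hK, show m - 60000 - (19812 - 564) = m - 79248 by omega,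
      List.getD_eq_getElem?_getD, List.getD_eq_getElem?_getD, List.getElem?_take,
      if_pos (by omega)]

/-- `certCellsLo` entry `m − 60000` is the table's `Φ⁻` of cell `m`. [folklore] -/
theorem certCellsLo_getD {m : ℕ} (h1 : 60000 ≤ m) (h2 : m < 80384) :
    certCellsLo.getD (m - 60000) 0 = (tabRun tabJ tabD tabK (m / tabK)).phiLo.getD (m % tabK) 0 := by
  unfold certCellsLo
  rw [cells_getD _ _ (tabRun_phi_length _ _ _ 3 (by norm_num)).1 h1 h2]
  have hK : tabK = 19812 := rfl
  by_cases hm : m / tabK = 3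
  · rw [if_pos hm, hm]
  · have h4 : m / tabK = 4 := by rw [hK] at hm ⊢; omega
    rw [if_neg hm, h4]

/-- `certCellsHi` entry `m − 60000` is the table's `Φ⁺` of cell `m`. [folklore] -/
theorem certCellsHi_getD {m : ℕ} (h1 : 60000 ≤ m) (h2 : m < 80384) :
    certCellsHi.getD (m - 60000) 0 = (tabRun tabJ tabD tabK (m / tabK)).phiHi.getD (m % tabK) 0 := by
  unfold certCellsHi
  rw [cells_getD _ _ (tabRun_phi_length _ _ _ 3 (by norm_num)).2 h1 h2]
  have hK : tabK = 19812 := rfl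
  by_cases hm : m / tabK = 3
  · rw [if_pos hm, hm]
  · have h4 : m / tabK = 4 := by rw [hK] at hm ⊢; omega
    rw [if_neg hm, h4]

/-- Lengths of the cell lists. [folklore] -/
theorem certCells_length : certCellsLo.length = 20384 ∧ certCellsHi.length = 20384 := by
  unfold certCellsLo certCellsHi
  have h3 := tabRun_phi_length tabJ tabD tabK 3 (by norm_num)
  have h4 := tabRun_phi_length tabJ tabD tabK 4 (by norm_num)
  simp only [List.length_append, List.length_drop, List.length_take, h3.1, h3.2, h4.1, h4.2]
  decide

/-- **The checker's range lookups enclose `Φ₆`.**  For `60000 ≤ lo ≤ m < hi ≤ 80384` and `y ∈ (x_m, x_{m+1}]`: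
`phiLoRange certBlockLo lo hi / D ≤ Φ₆(y) ≤ phiHiRange certBlockHi lo hi / D`. [folklore] -/
theorem phiSix_range_bounds {lo hi m : ℕ} (hlo : 60000 ≤ lo) (hhi : hi ≤ 80384) (hm1 : lo ≤ m) (hm2 : m < hi)
    {y : ℝ} (hy : y ∈ Set.Ioc ((m : ℝ) / tabJ) (((m : ℝ) + 1) / tabJ)) :
    ((phiLoRange certBlockLo lo hi : ℕ) : ℝ) / tabD ≤
        ∑ k ∈ Finset.Icc 1 6, (1 / (k.factorial : ℝ)) *
          cpow (fun t : ℝ => if (1651 / 10000 : ℝ) < t then 1 / t else 0) k y ∧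
      ∑ k ∈ Finset.Icc 1 6, (1 / (k.factorial : ℝ)) *
          cpow (fun t : ℝ => if (1651 / 10000 : ℝ) < t then 1 / t else 0) k y ≤
        ((phiHiRange certBlockHi lo hi : ℕ) : ℝ) / tabD := by
  have hK : tabK = 19812 := rfl
  have hD : (0 : ℝ) < tabD := by norm_num [tabD]
  have h60 : 60000 ≤ m := hlo.trans hm1
  have h80 : m < 80384 := lt_of_lt_of_le hm2 hhi
  obtain ⟨hlow, hupp⟩ := phiSix_cell_bounds (m := m) (by rw [hK]; omega) (by rw [hK]; omega) hy
  have hlen := certCells_length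
  constructor
  · refine le_trans ?_ hlow
    apply div_le_div_of_nonneg_right _ hD.le
    rw [← certCellsLo_getD h60 h80]
    exact_mod_cast phiLoRange_le (n := 1274) certCellsLo_lt hlo (by omega) hm1 hm2 (by rw [hlen.1]; omega)
  · refine le_trans hupp ?_
    apply div_le_div_of_nonneg_right _ hD.le
    rw [← certCellsHi_getD h60 h80]
    exact_mod_cast le_phiHiRange (n := 1274) certCellsHi_lt hlo (by omega) hm1 hm2 (by rw [hlen.2]; omega)

end Summit.Parity.GeneralizedHardyLittlewood.FordMaynardSieveConst01651SieveConst01651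

end
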